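import Summits.CriticalPhenomena.PercolationContinuityZ3.Theorems.PercNearOneGluingNoHeavyQuantTorqueHallB
import Summits.CriticalPhenomena.PercolationContinuityZ3.Theorems.PercNearOneGluingNoHeavyQuantSymTripleTwoChain
import Summits.CriticalPhenomena.PercolationContinuityZ3.Theorems.PercNearOneGluingNoHeavyQuantTripleTwoChainCertsA
import Summits.CriticalPhenomena.PercolationContinuityZ3.Theorems.PercNearOneGluingNoHeavyQuantTripleTwoChainCertsB
import Summits.CriticalPhenomena.PercolationContinuityZ3.Theorems.PercNearOneGluingNoHeavyQuantTripleTwoChainCertsC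
import HarnessLib

/-!
# QUANT lane R8, T-DEC: README V393's MINIMAL OPEN INSTANCE IN FULL GENERALITY — three NON-identical 2-chains
# `o[a](R[q₁](R[p₁]) R[q₂](R[p₂]) R[q₃](R[p₃]))` are SDEC at every top-affordable floor, for every root gate (arm-1 gen 55, architect)

builds on p205010 (kernel theorem, internal audit signed; external expert review pending)

Support file (`--supports stmt-CriticalPhenomena-4575`), QUANT lane seat prim-quant-arm-1 (gen 55, architect); memo
`run/shared/lean/prim/quant/prim-quant-arm-1-g55/ARCH-G55.md`.  Theorems only, standard axioms, no sorries.  Gen 54 closed the SYMMETRIC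
instance (`sdec_tc3`, `…QuantSymTripleTwoChain`: one route per low atom, four hand-proved capacity inequalities) and left the NON-identical
triple — the lane's minimal open instance of the sibling step (`SiblingStep` / `GateStepN`), README V393, RATE-PLAN §55.7 — with a numerical
certificate only (kit j273133/j273219: 400 000 / 400 000 exact).  THIS FILE proves it: for all gates `0 < qᵢ < 1`, `0 < pᵢ < 1` and every
floor `0 < x` with `6x ≤ s = Σ qᵢ(1 + pᵢ)` (all top-affordable floors, in particular every tree-OK floor), the forest law of
`[R[q₁](R[p₁]), R[q₂](R[p₂]), R[q₃](R[p₃])]` is `SDEC x 6`.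

THE CERTIFICATE (layer-free, per outer gate `a`; `T = a·s`, `y = a·x ≤ T/6`, `κ = T/(6−T)` bounds every rate used; arm-1 g50's torque-cost
criterion through this seat's wrappers `decAt_all_of_split1` (`…QuantTorqueSplitRoutes`) / `decAt_all_of_hall12b` (`…QuantTorqueHallB`)):
* `T ≤ 2`: no positive low atom (`decAt_all_of_noPosLow`);
* `2 < T ≤ 12/5`: the low atom `1` split over `{2, 3, 4}` at rate `κ` — capacity `tcIneq_Ba`;
* `12/5 < T ≤ 3`: the same routes, `1 → 2` at rate `(T−2)/(3−T)` with capacity `3(3−T)μ₂/T ≤ (3−T)μ₂/(T−2)` — `tcIneq_Bb3`;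
* `3 < T ≤ 4`: `1` split over `{3, 4, 5}`, `1 → 3` at `(T−2)/(4−T)` — `tcIneq_C`;
* `4 < T ≤ 24/5`: water-filling `1 → 5, 6`, `2 → 3, 4, 5, 6` under Hall's conditions with `N(1) ⊆ N(2)` (`tcIneq_cap1/cap12lo`) and three
  torque-cost conditions (`tcIneq_costU/costUplo/costUWlo`);
* `24/5 < T < 6`: the same without the route `2 → 3` (`tcIneq_cap1/cap12hi/costU/costUphi/costUWhilin`, the last two linearised in `T`).
The eleven inequalities are linear in the atoms `f_h = [Xʰ]Π(αᵢ + βᵢX + γᵢX²)` (`αᵢ = 1−qᵢ`, `βᵢ = qᵢ(1−pᵢ)`, `γᵢ = qᵢpᵢ`) and hold for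
ALL triples of laws on `{0,1,2}` (`…QuantTripleTwoChainCertsA–C`, exact machine-found Handelman certificates, kit j274885/j276081/j276254); the assembly multiplies them by `a`.

* `flaw_tc3g_eq`, `flaw_tc3g_one … flaw_tc3g_six`: the atoms of the forest law as `tA1 … tA6` of `(1−qᵢ, qᵢ(1−pᵢ), qᵢpᵢ)`.
* **`sdec_tc3g`**: `0 < qᵢ < 1`, `0 < pᵢ < 1`, `0 < x`, `6x ≤ Σ qᵢ(1+pᵢ)` ⟹ `SDEC x 6 (flaw [t₁,t₂,t₃])`.
* **`sdec_triple_twoChain`**: the `Sib.TreeOK` form at every tree-OK floor (true floors included) — no oracle, no symmetry, every `q`.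

HONEST STATUS.  Closes README V393's minimal open instance in full generality; the general width-3 sibling step (arbitrary composite
siblings), `SiblingStep`, `GateStepN`, `LightResidDECOracle`, `FarTreeRow` remain OPEN; RATE class (log\*) / honest sentence of
`run/shared/lean/prim/quant/README.md` unchanged.  [this work].  Nothing here is cited as a published result.  The gluing rows served
[cite: KozmaNitzan2024, Conjecture 3 (p. 15)]; product measure [cite: Grimmett1999, §1.3 p. 10].
-/

noncomputable section

open scoped BigOperators

namespace Summit.CriticalPhenomena.PercolationContinuityZ3.Theorems
namespace Quant
namespace LawDec

open Finset

/-- the point mass `δ_K` -/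
local notation3 "δ[" K "]" => (fun k : ℕ => if k = (K : ℕ) then (1 : ℝ) else 0)

/-- the 2-chain sub-forest law `ρ_p = δ₁ ∗ gate_p δ₁` -/
local notation3 "ρ₂[" p "]" => lconv 1 1 (fun k : ℕ => if k = (1 : ℕ) then (1 : ℝ) else 0)
  (gate (fun k : ℕ => if k = (1 : ℕ) then (1 : ℝ) else 0) p)

/-- the 2-chain sibling `t = gate_q(δ₁ ∗ gate_p δ₁)` with recorded sub-floor `x₁` -/
local notation3 "TC[" q ", " p ", " x₁ "]" => (⟨q, x₁, 1, 2, ρ₂[p]⟩ : Sib)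

/-- the general triple of 2-chains -/
local notation3 "L₃[" q₁ ", " p₁ ", " x₁ "; " q₂ ", " p₂ ", " x₂ "; " q₃ ", " p₃ ", " x₃ "]" =>
  ([TC[q₁, p₁, x₁], TC[q₂, p₂, x₂], TC[q₃, p₃, x₃]] : List Sib)

/-- `f₁ = Σ bᵢ aⱼ aₖ` (the atom notation of `…QuantTripleTwoChainCertsA–C`, restated) -/
local notation3 "tA1[" a₁ ", " b₁ ", " a₂ ", " b₂ ", " a₃ ", " b₃ "]" => (b₁ * a₂ * a₃ + a₁ * b₂ * a₃ + a₁ * a₂ * b₃ : ℝ)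
/-- `f₂ = Σ cᵢ aⱼ aₖ + Σ bᵢ bⱼ aₖ` -/
local notation3 "tA2[" a₁ ", " b₁ ", " c₁ ", " a₂ ", " b₂ ", " c₂ ", " a₃ ", " b₃ ", " c₃ "]" =>
  (c₁ * a₂ * a₃ + a₁ * c₂ * a₃ + a₁ * a₂ * c₃ + b₁ * b₂ * a₃ + b₁ * a₂ * b₃ + a₁ * b₂ * b₃ : ℝ)
/-- `f₃ = b₁b₂b₃ + Σ cᵢ bⱼ aₖ` -/
local notation3 "tA3[" a₁ ", " b₁ ", " c₁ ", " a₂ ", " b₂ ", " c₂ ", " a₃ ", " b₃ ", " c₃ "]" =>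
  (b₁ * b₂ * b₃ + c₁ * b₂ * a₃ + c₁ * a₂ * b₃ + b₁ * c₂ * a₃ + a₁ * c₂ * b₃ + b₁ * a₂ * c₃ + a₁ * b₂ * c₃ : ℝ)
/-- `f₄ = Σ aᵢ cⱼ cₖ + Σ cᵢ bⱼ bₖ` -/
local notation3 "tA4[" a₁ ", " b₁ ", " c₁ ", " a₂ ", " b₂ ", " c₂ ", " a₃ ", " b₃ ", " c₃ "]" =>
  (c₁ * c₂ * a₃ + c₁ * a₂ * c₃ + a₁ * c₂ * c₃ + c₁ * b₂ * b₃ + b₁ * c₂ * b₃ + b₁ * b₂ * c₃ : ℝ)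
/-- `f₅ = Σ bᵢ cⱼ cₖ` -/
local notation3 "tA5[" b₁ ", " c₁ ", " b₂ ", " c₂ ", " b₃ ", " c₃ "]" => (b₁ * c₂ * c₃ + c₁ * b₂ * c₃ + c₁ * c₂ * b₃ : ℝ)
/-- `f₆ = c₁c₂c₃` -/
local notation3 "tA6[" c₁ ", " c₂ ", " c₃ "]" => (c₁ * c₂ * c₃ : ℝ)

/-- the atoms of the triple of 2-chains: `tA_h` at `(aᵢ, bᵢ, cᵢ) = (1 − qᵢ, 1 − (1 − qᵢ) − qᵢpᵢ, qᵢpᵢ)` (the form the certificates take) -/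
local notation3 "F1[" q₁ ", " p₁ "; " q₂ ", " p₂ "; " q₃ ", " p₃ "]" =>
  tA1[(1 - q₁), (1 - (1 - q₁) - q₁ * p₁), (1 - q₂), (1 - (1 - q₂) - q₂ * p₂), (1 - q₃), (1 - (1 - q₃) - q₃ * p₃)]
local notation3 "F2[" q₁ ", " p₁ "; " q₂ ", " p₂ "; " q₃ ", " p₃ "]" =>
  tA2[(1 - q₁), (1 - (1 - q₁) - q₁ * p₁), (q₁ * p₁), (1 - q₂), (1 - (1 - q₂) - q₂ * p₂), (q₂ * p₂), (1 - q₃), (1 - (1 - q₃) - q₃ * p₃), (q₃ * p₃)]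
local notation3 "F3[" q₁ ", " p₁ "; " q₂ ", " p₂ "; " q₃ ", " p₃ "]" =>
  tA3[(1 - q₁), (1 - (1 - q₁) - q₁ * p₁), (q₁ * p₁), (1 - q₂), (1 - (1 - q₂) - q₂ * p₂), (q₂ * p₂), (1 - q₃), (1 - (1 - q₃) - q₃ * p₃), (q₃ * p₃)]
local notation3 "F4[" q₁ ", " p₁ "; " q₂ ", " p₂ "; " q₃ ", " p₃ "]" =>
  tA4[(1 - q₁), (1 - (1 - q₁) - q₁ * p₁), (q₁ * p₁), (1 - q₂), (1 - (1 - q₂) - q₂ * p₂), (q₂ * p₂), (1 - q₃), (1 - (1 - q₃) - q₃ * p₃), (q₃ * p₃)]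
local notation3 "F5[" q₁ ", " p₁ "; " q₂ ", " p₂ "; " q₃ ", " p₃ "]" =>
  tA5[(1 - (1 - q₁) - q₁ * p₁), (q₁ * p₁), (1 - (1 - q₂) - q₂ * p₂), (q₂ * p₂), (1 - (1 - q₃) - q₃ * p₃), (q₃ * p₃)]
local notation3 "F6[" q₁ ", " p₁ "; " q₂ ", " p₂ "; " q₃ ", " p₃ "]" => tA6[(q₁ * p₁), (q₂ * p₂), (q₃ * p₃)]

/-! ### The atoms of the forest law -/

/-- the forest law of three 2-chains as a nested convolution of the gated 2-chains. [this work] -/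
theorem flaw_tc3g_eq (q₁ p₁ x₁ q₂ p₂ x₂ q₃ p₃ x₃ : ℝ) :
    flaw L₃[q₁, p₁, x₁; q₂, p₂, x₂; q₃, p₃, x₃]
      = lconv 4 2 (lconv 2 2 (gate (ρ₂[p₃]) q₃) (gate (ρ₂[p₂]) q₂)) (gate (ρ₂[p₁]) q₁) := by
  have e1 : lconv 0 2 δ[0] (gate (ρ₂[p₃]) q₃) = gate (ρ₂[p₃]) q₃ := by
    funext k
    refine lconv_delta_left 0 2 _ (fun i hi => ?_) k
    rw [gate_tc_apply, if_neg (by omega), if_neg (by omega), if_neg (by omega)]; ring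
  show lconv (0 + 2 + 2) 2 (lconv (0 + 2) 2 (lconv 0 2 δ[0] (gate (ρ₂[p₃]) q₃)) (gate (ρ₂[p₂]) q₂)) (gate (ρ₂[p₁]) q₁) = _
  rw [e1]

/-- `f₁`. [this work] -/
theorem flaw_tc3g_one (q₁ p₁ x₁ q₂ p₂ x₂ q₃ p₃ x₃ : ℝ) :
    flaw L₃[q₁, p₁, x₁; q₂, p₂, x₂; q₃, p₃, x₃] 1 = F1[q₁, p₁; q₂, p₂; q₃, p₃] := by
  rw [flaw_tc3g_eq]; simp only [lconv, Finset.sum_range_succ, Finset.sum_range_zero, gate_tc_apply]; norm_num; ring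

/-- `f₂`. [this work] -/
theorem flaw_tc3g_two (q₁ p₁ x₁ q₂ p₂ x₂ q₃ p₃ x₃ : ℝ) :
    flaw L₃[q₁, p₁, x₁; q₂, p₂, x₂; q₃, p₃, x₃] 2 = F2[q₁, p₁; q₂, p₂; q₃, p₃] := by
  rw [flaw_tc3g_eq]; simp only [lconv, Finset.sum_range_succ, Finset.sum_range_zero, gate_tc_apply]; norm_num; ring

/-- `f₃`. [this work] -/
theorem flaw_tc3g_three (q₁ p₁ x₁ q₂ p₂ x₂ q₃ p₃ x₃ : ℝ) :
    flaw L₃[q₁, p₁, x₁; q₂, p₂, x₂; q₃, p₃, x₃] 3 = F3[q₁, p₁; q₂, p₂; q₃, p₃] := by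
  rw [flaw_tc3g_eq]; simp only [lconv, Finset.sum_range_succ, Finset.sum_range_zero, gate_tc_apply]; norm_num; ring

/-- `f₄`. [this work] -/
theorem flaw_tc3g_four (q₁ p₁ x₁ q₂ p₂ x₂ q₃ p₃ x₃ : ℝ) :
    flaw L₃[q₁, p₁, x₁; q₂, p₂, x₂; q₃, p₃, x₃] 4 = F4[q₁, p₁; q₂, p₂; q₃, p₃] := by
  rw [flaw_tc3g_eq]; simp only [lconv, Finset.sum_range_succ, Finset.sum_range_zero, gate_tc_apply]; norm_num; ring

/-- `f₅`. [this work] -/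
theorem flaw_tc3g_five (q₁ p₁ x₁ q₂ p₂ x₂ q₃ p₃ x₃ : ℝ) :
    flaw L₃[q₁, p₁, x₁; q₂, p₂, x₂; q₃, p₃, x₃] 5 = F5[q₁, p₁; q₂, p₂; q₃, p₃] := by
  rw [flaw_tc3g_eq]; simp only [lconv, Finset.sum_range_succ, Finset.sum_range_zero, gate_tc_apply]; norm_num; ring

/-- `f₆`. [this work] -/
theorem flaw_tc3g_six (q₁ p₁ x₁ q₂ p₂ x₂ q₃ p₃ x₃ : ℝ) :
    flaw L₃[q₁, p₁, x₁; q₂, p₂, x₂; q₃, p₃, x₃] 6 = F6[q₁, p₁; q₂, p₂; q₃, p₃] := by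
  rw [flaw_tc3g_eq]; simp only [lconv, Finset.sum_range_succ, Finset.sum_range_zero, gate_tc_apply]; norm_num; ring

/-! ### Assembly -/

set_option maxHeartbeats 1600000 in
/-- **THREE NON-IDENTICAL 2-CHAINS ARE SDEC AT EVERY TOP-AFFORDABLE FLOOR, FOR EVERY ROOT GATE.**  `0 < qᵢ < 1`, `0 < pᵢ < 1`, `0 < x`,
`6x ≤ Σ qᵢ(1+pᵢ)` ⟹ `SDEC x 6 (flaw [t₁,t₂,t₃])`, `tᵢ = gate_{qᵢ}(δ₁ ∗ gate_{pᵢ} δ₁)` (any recorded sub-floors).  No oracle. [this work] -/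
theorem sdec_tc3g {q₁ p₁ q₂ p₂ q₃ p₃ x : ℝ} (hq₁0 : 0 < q₁) (hq₁1 : q₁ < 1) (hp₁0 : 0 < p₁) (hp₁1 : p₁ < 1)
    (hq₂0 : 0 < q₂) (hq₂1 : q₂ < 1) (hp₂0 : 0 < p₂) (hp₂1 : p₂ < 1) (hq₃0 : 0 < q₃) (hq₃1 : q₃ < 1) (hp₃0 : 0 < p₃) (hp₃1 : p₃ < 1)
    (hx0 : 0 < x) (hx : 6 * x ≤ q₁ * (1 + p₁) + q₂ * (1 + p₂) + q₃ * (1 + p₃)) (x₁ x₂ x₃ : ℝ) :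
    SDEC x 6 (flaw L₃[q₁, p₁, x₁; q₂, p₂, x₂; q₃, p₃, x₃]) := by
  intro a ha0 ha1 j hj
  -- scalars
  obtain ⟨s, hsdef⟩ : ∃ s : ℝ, s = q₁ * (1 + p₁) + q₂ * (1 + p₂) + q₃ * (1 + p₃) := ⟨_, rfl⟩
  obtain ⟨T, hTdef⟩ : ∃ T : ℝ, T = a * s := ⟨_, rfl⟩
  have hs6 : s < 6 := by rw [hsdef]; nlinarith
  have hs0 : 0 < s := by rw [hsdef]; positivity
  have hTs : T ≤ s := by rw [hTdef]; nlinarith [mul_nonneg (sub_nonneg.2 ha1) hs0.le]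
  have hT6 : T < 6 := by linarith
  have hT0 : 0 < T := by rw [hTdef]; positivity
  have hyT : 6 * (a * x) ≤ T := by
    have h := mul_le_mul_of_nonneg_left hx ha0.le
    rw [← hsdef] at h
    rw [hTdef]; linarith
  have hy0 : 0 < a * x := mul_pos ha0 hx0
  have hy1 : a * x < 1 := by linarith
  have hta : a * x * ((6 : ℕ) : ℝ) ≤ T := by push_cast; linarith
  -- the coordinates of the three laws on {0,1,2}
  have hα₁ : 0 ≤ 1 - q₁ := by linarith
  have hα₂ : 0 ≤ 1 - q₂ := by linarith
  have hα₃ : 0 ≤ 1 - q₃ := by linarith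
  have hγ₁ : 0 ≤ q₁ * p₁ := by positivity
  have hγ₂ : 0 ≤ q₂ * p₂ := by positivity
  have hγ₃ : 0 ≤ q₃ * p₃ := by positivity
  have hβ₁ : 0 ≤ 1 - (1 - q₁) - q₁ * p₁ := by
    have e : 1 - (1 - q₁) - q₁ * p₁ = q₁ * (1 - p₁) := by ring
    rw [e]; exact mul_nonneg hq₁0.le (by linarith)
  have hβ₂ : 0 ≤ 1 - (1 - q₂) - q₂ * p₂ := by
    have e : 1 - (1 - q₂) - q₂ * p₂ = q₂ * (1 - p₂) := by ring
    rw [e]; exact mul_nonneg hq₂0.le (by linarith)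
  have hβ₃ : 0 ≤ 1 - (1 - q₃) - q₃ * p₃ := by
    have e : 1 - (1 - q₃) - q₃ * p₃ = q₃ * (1 - p₃) := by ring
    rw [e]; exact mul_nonneg hq₃0.le (by linarith)
  have hTs' : T ≤ 1 - (1 - q₁) + q₁ * p₁ + (1 - (1 - q₂) + q₂ * p₂) + (1 - (1 - q₃) + q₃ * p₃) := by
    have e : 1 - (1 - q₁) + q₁ * p₁ + (1 - (1 - q₂) + q₂ * p₂) + (1 - (1 - q₃) + q₃ * p₃) = s := by rw [hsdef]; ring
    rw [e]; exact hTs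
  -- law facts
  have ρ0 : ∀ p : ℝ, 0 ≤ p → p ≤ 1 → ∀ h, 0 ≤ (ρ₂[p]) h := by
    intro p hp0 hp1 h; rw [tc_rho_apply]; split_ifs <;> linarith
  have ρM : ∀ p : ℝ, ∀ h, 2 < h → (ρ₂[p]) h = 0 := by
    intro p h hh; rw [tc_rho_apply, if_neg (by omega), if_neg (by omega)]; ring
  have ρ1 : ∀ p : ℝ, ∑ h ∈ Finset.range (2 + 1), (ρ₂[p]) h = 1 := by
    intro p; simp [Finset.sum_range_succ, tc_rho_apply]
  have hmeanρ : ∀ p x₀ q : ℝ, Sib.mean TC[q, p, x₀] = 1 + p := by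
    intro p x₀ q; simp [Sib.mean, Finset.sum_range_succ, tc_rho_apply]; ring
  have hOK : ∀ t ∈ L₃[q₁, p₁, x₁; q₂, p₂, x₂; q₃, p₃, x₃], t.LawOK := by
    intro t ht
    simp only [List.mem_cons, List.mem_nil_iff, or_false] at ht
    rcases ht with rfl | rfl | rfl
    · exact ⟨hq₁0, hq₁1, ρ0 p₁ hp₁0.le hp₁1.le, ρM p₁, ρ1 p₁⟩
    · exact ⟨hq₂0, hq₂1, ρ0 p₂ hp₂0.le hp₂1.le, ρM p₂, ρ1 p₂⟩
    · exact ⟨hq₃0, hq₃1, ρ0 p₃ hp₃0.le hp₃1.le, ρM p₃, ρ1 p₃⟩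
  obtain ⟨f0, fM, f1, fmn⟩ := flaw_facts L₃[q₁, p₁, x₁; q₂, p₂, x₂; q₃, p₃, x₃] hOK
  have htop : ftop L₃[q₁, p₁, x₁; q₂, p₂, x₂; q₃, p₃, x₃] = 6 := rfl
  have hfmean : fmean L₃[q₁, p₁, x₁; q₂, p₂, x₂; q₃, p₃, x₃] = s := by
    simp only [fmean, hmeanρ]; rw [hsdef]; ring
  rw [htop] at fM f1 fmn
  rw [hfmean] at fmn
  set μ : ℕ → ℝ := gate (flaw L₃[q₁, p₁, x₁; q₂, p₂, x₂; q₃, p₃, x₃]) a with hμ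
  obtain ⟨g0, gM, g1⟩ := gate_laws 6 (flaw L₃[q₁, p₁, x₁; q₂, p₂, x₂; q₃, p₃, x₃]) a ha0.le ha1 f0 fM f1
  have gmn : ∑ h ∈ Finset.range (6 + 1), (h : ℝ) * μ h = T := by
    rw [hμ, sum_mul_gate, fmn, hTdef]
  -- the atoms of the gated law
  have μ1 : μ 1 = a * F1[q₁, p₁; q₂, p₂; q₃, p₃] := by rw [hμ, gate_apply, flaw_tc3g_one]; simp
  have μ2 : μ 2 = a * F2[q₁, p₁; q₂, p₂; q₃, p₃] := by rw [hμ, gate_apply, flaw_tc3g_two]; simp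
  have μ3 : μ 3 = a * F3[q₁, p₁; q₂, p₂; q₃, p₃] := by rw [hμ, gate_apply, flaw_tc3g_three]; simp
  have μ4 : μ 4 = a * F4[q₁, p₁; q₂, p₂; q₃, p₃] := by rw [hμ, gate_apply, flaw_tc3g_four]; simp
  have μ5 : μ 5 = a * F5[q₁, p₁; q₂, p₂; q₃, p₃] := by rw [hμ, gate_apply, flaw_tc3g_five]; simp
  have μ6 : μ 6 = a * F6[q₁, p₁; q₂, p₂; q₃, p₃] := by rw [hμ, gate_apply, flaw_tc3g_six]; simp
  -- capacities in units of low mass are nonnegative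
  have hc6 : ∀ h, 0 ≤ (6 - T) * μ h / T := fun h => div_nonneg (mul_nonneg (by linarith) (g0 h)) hT0.le
  -- regimes
  rcases le_or_gt T 2 with hT2 | hT2
  · exact decAt_all_of_noPosLow (a * x) 6 μ T hy0 hy1 g0 gM g1 gmn hT0 hT2 hta j hj
  rcases le_or_gt T (12 / 5) with hT24 | hT24
  · -- regime 2 < T ≤ 12/5: the low atom 1 over {2,3,4}, all at rate ≤ κ
    have hineq := tcIneq_Ba (1 - q₁) (q₁ * p₁) (1 - q₂) (q₂ * p₂) (1 - q₃) (q₃ * p₃) T hα₁ hγ₁ hβ₁ hα₂ hγ₂ hβ₂ hα₃ hγ₃ hβ₃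
      hT2.le hT24 hTs'
    obtain ⟨y₂, y₃, y₄, hy₂, hy₃, hy₄, hsum, hle₂, hle₃, hle₄⟩ := exists_split3 (μ 1) ((6 - T) * μ 2 / T) ((6 - T) * μ 3 / T)
      ((6 - T) * μ 4 / T) (g0 1) (hc6 2) (hc6 3) (hc6 4) (by
        rw [add_div_three, le_div_iff₀ hT0, μ1, μ2, μ3, μ4]; linarith [mul_nonneg ha0.le hineq])
    refine decAt_all_of_split1 (a * x) 2 3 4 y₂ y₃ y₄ μ T hy0 hy1 g0 gM g1 gmn hT2 (by linarith) hta (by norm_num) (by norm_num)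
      (by norm_num) (by norm_num) (by norm_num) (by norm_num) (by norm_num) (by norm_num) (by norm_num) hy₂ hy₃ hy₄ hsum
      (fun _ => by push_cast; linarith) (fun _ => by push_cast; linarith) (fun _ => by push_cast; linarith) ?_ ?_ ?_
      (fun h => absurd h (by push_cast; linarith)) ?_ ?_ j hj
    · exact cap_sixth _ _ _ T (freeRate_le_sixth (a * x) T 1 2 hyT (by push_cast; linarith) hT6) hy₂ hle₂ hT0 hT6
    · exact cap_sixth _ _ _ T (freeRate_le_sixth (a * x) T 1 3 hyT (by push_cast; linarith) hT6) hy₃ hle₃ hT0 hT6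
    · exact cap_sixth _ _ _ T (freeRate_le_sixth (a * x) T 1 4 hyT (by push_cast; linarith) hT6) hy₄ hle₄ hT0 hT6
    · intro h3
      exact route_cost6 _ T 3 _ (freeRate_le_sixth (a * x) T 1 3 hyT (by push_cast; linarith) hT6) hT6 hy₃ h3.le
        (route_cost_ineq T 3 (by linarith))
    · intro h4
      exact route_cost6 _ T 4 _ (freeRate_le_sixth (a * x) T 1 4 hyT (by push_cast; linarith) hT6) hT6 hy₄ h4.le
        (route_cost_ineq T 4 (by linarith))
  rcases le_or_gt T 3 with hT3 | hT3
  · -- regime 12/5 < T ≤ 3: the low atom 1 over {2,3,4}; the route 1 → 2 (rate (T−2)/(3−T)) at the smaller capacity 3(3−T)μ₂/T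
    have hineq := tcIneq_Bb3 (1 - q₁) (q₁ * p₁) (1 - q₂) (q₂ * p₂) (1 - q₃) (q₃ * p₃) T hα₁ hγ₁ hβ₁ hα₂ hγ₂ hβ₂ hα₃ hγ₃ hβ₃
      hT24.le hT3 hTs'
    have hc2 : 0 ≤ 3 * (3 - T) * μ 2 / T := div_nonneg (mul_nonneg (by linarith) (g0 2)) hT0.le
    obtain ⟨y₂, y₃, y₄, hy₂, hy₃, hy₄, hsum, hle₂, hle₃, hle₄⟩ := exists_split3 (μ 1) (3 * (3 - T) * μ 2 / T) ((6 - T) * μ 3 / T)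
      ((6 - T) * μ 4 / T) (g0 1) hc2 (hc6 3) (hc6 4) (by
        rw [add_div_three, le_div_iff₀ hT0, μ1, μ2, μ3, μ4]; linarith [mul_nonneg ha0.le hineq])
    -- the recorded capacity is below the true one `(3−T)μ₂/(T−2)` (as `T ≤ 3`)
    have hle₂' : y₂ ≤ (3 - T) * μ 2 / (T - 2) := by
      refine hle₂.trans ?_
      have hT2' : 0 < T - 2 := by linarith
      rw [div_le_div_iff₀ hT0 hT2']
      have h32 : 0 ≤ (3 - T) * μ 2 := mul_nonneg (by linarith) (g0 2)
      have e : (3 - T) * μ 2 * T - 3 * (3 - T) * μ 2 * (T - 2) = (3 - T) * μ 2 * (6 - 2 * T) := by ring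
      nlinarith [mul_nonneg h32 (by linarith : (0 : ℝ) ≤ 6 - 2 * T)]
    refine decAt_all_of_split1 (a * x) 2 3 4 y₂ y₃ y₄ μ T hy0 hy1 g0 gM g1 gmn hT2 (by linarith) hta (by norm_num) (by norm_num)
      (by norm_num) (by norm_num) (by norm_num) (by norm_num) (by norm_num) (by norm_num) (by norm_num) hy₂ hy₃ hy₄ hsum
      ?_ (fun _ => by push_cast; linarith) (fun _ => by push_cast; linarith) ?_ ?_ ?_
      (fun h => absurd h (by push_cast; linarith)) ?_ ?_ j hj
    · -- the route 1 → 2 is idle at T = 3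
      intro hpos
      rcases eq_or_lt_of_le hT3 with h3 | h3
      · exfalso
        have : y₂ ≤ 0 := by rw [h3] at hle₂; simpa using hle₂
        linarith
      · push_cast; linarith
    · exact cap_one_two (a * x) y₂ (μ 2) T hy0 hy1 (by linarith) hT3 hy₂ hle₂' (g0 2)
    · exact cap_sixth _ _ _ T (freeRate_le_sixth (a * x) T 1 3 hyT (by push_cast; linarith) hT6) hy₃ hle₃ hT0 hT6
    · exact cap_sixth _ _ _ T (freeRate_le_sixth (a * x) T 1 4 hyT (by push_cast; linarith) hT6) hy₄ hle₄ hT0 hT6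
    · intro h3
      exact route_cost6 _ T 3 _ (freeRate_le_sixth (a * x) T 1 3 hyT (by push_cast; linarith) hT6) hT6 hy₃ h3.le
        (route_cost_ineq T 3 (by linarith))
    · intro h4
      exact route_cost6 _ T 4 _ (freeRate_le_sixth (a * x) T 1 4 hyT (by push_cast; linarith) hT6) hT6 hy₄ h4.le
        (route_cost_ineq T 4 (by linarith))
  rcases le_or_gt T 4 with hT4 | hT4
  · -- regime 3 < T ≤ 4: the low atom 1 over {3,4,5}, the route 1 → 3 at rate (T−2)/(4−T)
    have hineq := tcIneq_C (1 - q₁) (q₁ * p₁) (1 - q₂) (q₂ * p₂) (1 - q₃) (q₃ * p₃) T hα₁ hγ₁ hβ₁ hα₂ hγ₂ hβ₂ hα₃ hγ₃ hβ₃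
      hT3.le hT4 hTs'
    have hT2' : 0 < T - 2 := by linarith
    have hc3 : 0 ≤ (4 - T) * μ 3 / (T - 2) := div_nonneg (mul_nonneg (by linarith) (g0 3)) hT2'.le
    obtain ⟨y₃, y₄, y₅, hy₃, hy₄, hy₅, hsum, hle₃, hle₄, hle₅⟩ := exists_split3 (μ 1) ((4 - T) * μ 3 / (T - 2)) ((6 - T) * μ 4 / T)
      ((6 - T) * μ 5 / T) (g0 1) hc3 (hc6 4) (hc6 5) (by
        have e : (4 - T) * μ 3 / (T - 2) + (6 - T) * μ 4 / T + (6 - T) * μ 5 / T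
            = (T * (4 - T) * μ 3 + (T - 2) * (6 - T) * (μ 4 + μ 5)) / (T * (T - 2)) := by
          field_simp; ring
        rw [e, le_div_iff₀ (mul_pos hT0 hT2'), μ1, μ3, μ4, μ5]; linarith [mul_nonneg ha0.le hineq])
    refine decAt_all_of_split1 (a * x) 3 4 5 y₃ y₄ y₅ μ T hy0 hy1 g0 gM g1 gmn hT2 hT4 hta (by norm_num) (by norm_num)
      (by norm_num) (by norm_num) (by norm_num) (by norm_num) (by norm_num) (by norm_num) (by norm_num) hy₃ hy₄ hy₅ hsum
      ?_ (fun _ => by push_cast; linarith) (fun _ => by push_cast; linarith) ?_ ?_ ?_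
      (fun h => absurd h (by push_cast; linarith)) ?_ ?_ j hj
    · -- the route 1 → 3 is idle at T = 4
      intro hpos
      rcases eq_or_lt_of_le hT4 with h4 | h4
      · exfalso
        have : y₃ ≤ 0 := by rw [h4] at hle₃; simpa using hle₃
        linarith
      · push_cast; linarith
    · exact cap_one_three (a * x) y₃ (μ 3) T hy0 hy1 (by linarith) hT4 hy₃ hle₃ (g0 3)
    · exact cap_sixth _ _ _ T (freeRate_le_sixth (a * x) T 1 4 hyT (by push_cast; linarith) hT6) hy₄ hle₄ hT0 hT6
    · exact cap_sixth _ _ _ T (freeRate_le_sixth (a * x) T 1 5 hyT (by push_cast; linarith) hT6) hy₅ hle₅ hT0 hT6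
    · intro h4
      exact route_cost6 _ T 4 _ (freeRate_le_sixth (a * x) T 1 4 hyT (by push_cast; linarith) hT6) hT6 hy₄ h4.le
        (route_cost_ineq T 4 (by linarith))
    · intro h5
      exact route_cost6 _ T 5 _ (freeRate_le_sixth (a * x) T 1 5 hyT (by push_cast; linarith) hT6) hT6 hy₅ h5.le
        (route_cost_ineq T 5 (by linarith))
  -- regimes 4 < T < 6: water-filling under Hall's conditions with N(1) = {5,6} ⊆ N(2) = {3,4,5,6}
  have hcap1 := tcIneq_cap1 (1 - q₁) (q₁ * p₁) (1 - q₂) (q₂ * p₂) (1 - q₃) (q₃ * p₃) T hα₁ hγ₁ hβ₁ hα₂ hγ₂ hβ₂ hα₃ hγ₃ hβ₃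
    hT4.le hT6.le hTs'
  have hcostU := tcIneq_costU (1 - q₁) (q₁ * p₁) (1 - q₂) (q₂ * p₂) (1 - q₃) (q₃ * p₃) T hα₁ hγ₁ hβ₁ hα₂ hγ₂ hβ₂ hα₃ hγ₃ hβ₃
    hT4.le hT6.le hTs'
  have hμ3 : 0 ≤ μ 3 := g0 3
  rcases le_or_gt T (24 / 5) with hT5 | hT5
  · -- 4 < T ≤ 24/5: the route 2 → 3 at rate ≤ κ
    have hcap12 := tcIneq_cap12lo (1 - q₁) (q₁ * p₁) (1 - q₂) (q₂ * p₂) (1 - q₃) (q₃ * p₃) T hα₁ hγ₁ hβ₁ hα₂ hγ₂ hβ₂ hα₃ hγ₃ hβ₃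
      hT4.le hT5 hTs'
    have hcostU' := tcIneq_costUplo (1 - q₁) (q₁ * p₁) (1 - q₂) (q₂ * p₂) (1 - q₃) (q₃ * p₃) T hα₁ hγ₁ hβ₁ hα₂ hγ₂ hβ₂ hα₃ hγ₃ hβ₃
      hT4.le hT5 hTs'
    have hcostUW := tcIneq_costUWlo (1 - q₁) (q₁ * p₁) (1 - q₂) (q₂ * p₂) (1 - q₃) (q₃ * p₃) T hα₁ hγ₁ hβ₁ hα₂ hγ₂ hβ₂ hα₃ hγ₃
      hβ₃ hT4.le hT5 hTs'
    have e3 : T * ((6 - T) * μ 3 / T) = (6 - T) * μ 3 := by field_simp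
    refine decAt_all_of_hall12b (a * x) μ T ((6 - T) * μ 3 / T) hy0 hy1 g0 gM g1 gmn hT4 hT6 hyT (hc6 3)
      (Or.inr ⟨by linarith, le_of_eq e3⟩) ?_ ?_ ?_ ?_ ?_ j hj
    · rw [μ1, μ5, μ6]; linarith [mul_nonneg ha0.le hcap1]
    · rw [e3, μ1, μ2, μ3, μ4, μ5, μ6]; linarith [mul_nonneg ha0.le hcap12]
    · rw [μ1, μ2, μ3, μ4, μ5]; linarith [mul_nonneg ha0.le hcostU]
    · rw [e3, μ1, μ3, μ4, μ5]; linarith [mul_nonneg ha0.le hcostU']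
    · rw [e3, μ1, μ2, μ3, μ4, μ5]; linarith [mul_nonneg ha0.le hcostUW]
  · -- 24/5 < T < 6: no route into 3; the cost conditions linearised with T − 3 ≥ 9/5
    have hcap12 := tcIneq_cap12hi (1 - q₁) (q₁ * p₁) (1 - q₂) (q₂ * p₂) (1 - q₃) (q₃ * p₃) T hα₁ hγ₁ hβ₁ hα₂ hγ₂ hβ₂ hα₃ hγ₃ hβ₃
      hT5.le hT6.le hTs'
    have hcostU' := tcIneq_costUphi (1 - q₁) (q₁ * p₁) (1 - q₂) (q₂ * p₂) (1 - q₃) (q₃ * p₃) T hα₁ hγ₁ hβ₁ hα₂ hγ₂ hβ₂ hα₃ hγ₃ hβ₃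
      hT5.le hT6.le hTs'
    have hcostUW := tcIneq_costUWhilin (1 - q₁) (q₁ * p₁) (1 - q₂) (q₂ * p₂) (1 - q₃) (q₃ * p₃) T hα₁ hγ₁ hβ₁ hα₂ hγ₂ hβ₂ hα₃ hγ₃
      hβ₃ hT5.le hT6.le hTs'
    have h95 : 9 / 5 * T * μ 3 ≤ T * ((T - 3) * μ 3) := by
      have h0 : 0 ≤ T * μ 3 := mul_nonneg hT0.le hμ3
      have e : T * ((T - 3) * μ 3) - 9 / 5 * T * μ 3 = (T - 24 / 5) * (T * μ 3) := by ring
      linarith [e, mul_nonneg (sub_nonneg.2 hT5.le) h0]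
    -- the two linearised cost conditions in terms of the gated atoms
    have hC1 : T * μ 1 - (6 - T) * μ 5 ≤ 9 / 5 * T * μ 3 + (4 * T - 12) * μ 4 := by
      rw [μ1, μ3, μ4, μ5]; linarith [mul_nonneg ha0.le hcostU']
    have hC2 : T * μ 1 - (6 - T) * μ 5 + 2 * (T * μ 2) ≤ 9 / 5 * T * μ 3 + 2 * (T * μ 4) := by
      rw [μ1, μ2, μ3, μ4, μ5]; linarith [mul_nonneg ha0.le hcostUW]
    refine decAt_all_of_hall12b (a * x) μ T 0 hy0 hy1 g0 gM g1 gmn hT4 hT6 hyT le_rfl (Or.inl rfl) ?_ ?_ ?_ ?_ ?_ j hj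
    · rw [μ1, μ5, μ6]; linarith [mul_nonneg ha0.le hcap1]
    · rw [mul_zero, zero_add, μ1, μ2, μ4, μ5, μ6]; linarith [mul_nonneg ha0.le hcap12]
    · rw [μ1, μ2, μ3, μ4, μ5]; linarith [mul_nonneg ha0.le hcostU]
    · have e : (T - 2) * (T * 0 + (6 - T) * μ 4) + T * ((T - 3) * μ 3 + (T - 4) * μ 4) = (4 * T - 12) * μ 4 + T * ((T - 3) * μ 3) := by
        ring
      rw [e]; linarith [hC1, h95]
    · have e : T * (T * 0) + T * ((T - 3) * μ 3) + 2 * (T * μ 4) = T * ((T - 3) * μ 3) + 2 * (T * μ 4) := by ring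
      rw [e]; linarith [hC2, h95]

/-- **THE GENERAL TRIPLE OF 2-CHAINS IS SDEC AT EVERY TREE-OK FLOOR, FOR EVERY ROOT GATE — NO ORACLE** (README V393's minimal open instance
in full generality).  For a floor `0 < x`, inner gates `0 < pᵢ < 1` and the 2-chain siblings `tᵢ = gate_{qᵢ}(δ₁ ∗ gate_{pᵢ} δ₁)` tree-OK at `x`
(any admissible sub-floors): `SDEC x (ftop [t₁,t₂,t₃]) (flaw [t₁,t₂,t₃])`. [this work] -/
theorem sdec_triple_twoChain {q₁ p₁ x₁ q₂ p₂ x₂ q₃ p₃ x₃ x : ℝ} (hx0 : 0 < x) (hp₁0 : 0 < p₁) (hp₁1 : p₁ < 1) (hp₂0 : 0 < p₂)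
    (hp₂1 : p₂ < 1) (hp₃0 : 0 < p₃) (hp₃1 : p₃ < 1) (ht₁ : Sib.TreeOK x TC[q₁, p₁, x₁]) (ht₂ : Sib.TreeOK x TC[q₂, p₂, x₂])
    (ht₃ : Sib.TreeOK x TC[q₃, p₃, x₃]) :
    SDEC x (ftop L₃[q₁, p₁, x₁; q₂, p₂, x₂; q₃, p₃, x₃]) (flaw L₃[q₁, p₁, x₁; q₂, p₂, x₂; q₃, p₃, x₃]) := by
  have hmean : ∀ p : ℝ, ∑ k ∈ Finset.range (2 + 1), (k : ℝ) * (ρ₂[p]) k = 1 + p := by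
    intro p; simp [Finset.sum_range_succ, tc_rho_apply]; ring
  have half : ∀ {q p x₀ : ℝ}, Sib.TreeOK x TC[q, p, x₀] → 0 < q ∧ q < 1 ∧ 2 * x ≤ q * (1 + p) := by
    intro q p x₀ ht
    obtain ⟨hq0, hq1, hxq, hT, _⟩ := ht
    obtain ⟨_, _, _, _, _, hta⟩ := hT.lawFacts
    have hta' : x₀ * 2 ≤ 1 + p := by
      change x₀ * ((2 : ℕ) : ℝ) ≤ ∑ k ∈ Finset.range (2 + 1), (k : ℝ) * (ρ₂[p]) k at hta
      rw [hmean] at hta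
      exact_mod_cast hta
    refine ⟨hq0, hq1, ?_⟩
    change x ≤ q * x₀ at hxq
    nlinarith
  obtain ⟨hq₁0, hq₁1, h₁⟩ := half ht₁
  obtain ⟨hq₂0, hq₂1, h₂⟩ := half ht₂
  obtain ⟨hq₃0, hq₃1, h₃⟩ := half ht₃
  have htop : ftop L₃[q₁, p₁, x₁; q₂, p₂, x₂; q₃, p₃, x₃] = 6 := rfl
  rw [htop]
  exact sdec_tc3g hq₁0 hq₁1 hp₁0 hp₁1 hq₂0 hq₂1 hp₂0 hp₂1 hq₃0 hq₃1 hp₃0 hp₃1 hx0 (by linarith) x₁ x₂ x₃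

end LawDec
end Quant
end Summit.CriticalPhenomena.PercolationContinuityZ3.Theorems
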